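import Summits.AtomisticToContinuum.HydrodynamicLimit.Theorems.EnskogAdjointDualityDualityReductionMaxwellian
import Literature.MathematicalPhysics.KineticTheory.Hilbert6Wave0
import HarnessLib

/-!
# EnskogAdjointDuality / DualityReduction — helper 6: growth bound for the test-side Enskog operator

Support lemmas for `Summit.AtomisticToContinuum.HydrodynamicLimit.Theses.EnskogAdjointDuality.DualityReduction`
(stmt-AtomisticToContinuum-11590). The test-side linearised Enskog operator of the route,
`(L^N_s φ)(x, v) = λ_N ∫_{S²} ∫ ((v−w)·ω)₊ Y(σ³ρ_s(x+εω/2)) f_s(x+εω, w)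
  [φ(x, v') + φ(x+εω, w') − φ(x, v) − φ(x+εω, w)] dw dσ(ω)`,
applied to an admissible test family (`|φ| ≤ C_φ (1 + |v|²)`), along an Euler solution whose
profiles are bounded on `[0, t] × 𝕋³` with the contact value `Y` bounded on the packing window,
grows at most like `(1 + |v|²)²`: `|L^N_s φ (x, v)| ≤ K (1 + |v|²)²` on `[0, t]`. The `w`-integral is
dominated by a Gaussian moment (helper 4), the `ω`-integral by the finite sphere measure.

* `abs_testFn_le` — `|φ^N| ≤ C_φ (1 + |v|²)` for the route's test functions `α + β·v + γ|v|²/2 + κ/λ_N`;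
* `abs_increment_le` — the collision increment of such a `φ` is `≤ 18 C_φ (1+|v|²)(1+|w|²)`;
* `abs_enskogL_le` — the growth bound.

References: H. Spohn, *Large Scale Dynamics of Interacting Particles* (1991), Part I §3;
M. Pulvirenti, S. Simonella, arXiv:1504.03215, §2 [PulvirentiSimonella2016].
-/

noncomputable section

open MeasureTheory Set Filter Topology
open scoped ENNReal BigOperators InnerProductSpace

namespace Summit.AtomisticToContinuum.HydrodynamicLimit.Theorems

open Literature.Analysis.FluidPDE Literature.MathematicalPhysics.KineticTheory

/-! ## Elementary velocity inequalities -/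

/-- `|v| ≤ 1 + |v|²`. [folklore] -/
private theorem norm_le_one_add_norm_sq (v : V3) : ‖v‖ ≤ 1 + ‖v‖ ^ 2 := by
  nlinarith [sq_nonneg (‖v‖ - 1), norm_nonneg v]

/-- Post-collisional velocities are controlled by the pre-collisional pair:
`1 + |v − ⟪v−w, ω⟫ω|² ≤ 8 (1+|v|²)(1+|w|²)` for a unit vector `ω`. [folklore] -/
private theorem one_add_norm_sq_out_le (v w : V3) (ω : Metric.sphere (0 : V3) 1) (c : ℝ)
    (hc : |c| ≤ ‖v - w‖) :
    1 + ‖v + c • (ω : V3)‖ ^ 2 ≤ 8 * ((1 + ‖v‖ ^ 2) * (1 + ‖w‖ ^ 2)) := by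
  have hω : ‖(ω : V3)‖ = 1 := norm_eq_of_mem_sphere ω
  have h1 : ‖v + c • (ω : V3)‖ ≤ 2 * ‖v‖ + ‖w‖ := by
    calc ‖v + c • (ω : V3)‖ ≤ ‖v‖ + ‖c • (ω : V3)‖ := norm_add_le _ _
      _ = ‖v‖ + |c| := by rw [norm_smul, Real.norm_eq_abs, hω, mul_one]
      _ ≤ ‖v‖ + ‖v - w‖ := by linarith
      _ ≤ ‖v‖ + (‖v‖ + ‖w‖) := by linarith [norm_sub_le v w]
      _ = 2 * ‖v‖ + ‖w‖ := by ring
  have h2 : ‖v + c • (ω : V3)‖ ^ 2 ≤ (2 * ‖v‖ + ‖w‖) ^ 2 :=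
    pow_le_pow_left₀ (norm_nonneg _) h1 2
  nlinarith [sq_nonneg (2 * ‖v‖ - ‖w‖), norm_nonneg v, norm_nonneg w,
    mul_nonneg (sq_nonneg ‖v‖) (sq_nonneg ‖w‖)]

/-! ## The test functions -/

/-- **Quadratic growth of the route's test functions.** For an admissible family
(`‖c^N_s(x)‖ ≤ C`, `|κ^N| ≤ C(1+|v|²)`),
`|α + ⟪β, v⟫ + γ|v|²/2 + λ⁻¹ κ| ≤ (3C + |λ⁻¹| C)(1 + |v|²)`. [folklore] -/
theorem abs_testFn_le {c : ℝ × V3 × ℝ} {κv : ℝ} {C lamInv : ℝ} (v : V3)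
    (hc : ‖c‖ ≤ C) (hκ : |κv| ≤ C * (1 + ‖v‖ ^ 2)) :
    |c.1 + ⟪c.2.1, v⟫_ℝ + c.2.2 * ‖v‖ ^ 2 / 2 + lamInv * κv| ≤
      (3 * C + |lamInv| * C) * (1 + ‖v‖ ^ 2) := by
  have hC0 : 0 ≤ C := (norm_nonneg _).trans hc
  have h1 : |c.1| ≤ C := (norm_fst_le c).trans hc
  have h2 : ‖c.2.1‖ ≤ C := ((norm_fst_le c.2).trans (norm_snd_le c)).trans hc
  have h3 : |c.2.2| ≤ C := by
    have := (norm_snd_le c.2).trans (norm_snd_le c)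
    exact le_trans (by simp [Real.norm_eq_abs]) (this.trans hc)
  have hv := norm_le_one_add_norm_sq v
  have hv0 : 0 ≤ ‖v‖ := norm_nonneg v
  calc |c.1 + ⟪c.2.1, v⟫_ℝ + c.2.2 * ‖v‖ ^ 2 / 2 + lamInv * κv|
      ≤ |c.1| + |⟪c.2.1, v⟫_ℝ| + |c.2.2 * ‖v‖ ^ 2 / 2| + |lamInv * κv| := by
        refine (abs_add_le _ _).trans (add_le_add ((abs_add_three _ _ _)) le_rfl)
    _ ≤ C + C * ‖v‖ + C * ‖v‖ ^ 2 / 2 + |lamInv| * (C * (1 + ‖v‖ ^ 2)) := by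
        have hi : |⟪c.2.1, v⟫_ℝ| ≤ C * ‖v‖ :=
          (abs_real_inner_le_norm _ _).trans (mul_le_mul_of_nonneg_right h2 hv0)
        have hq : |c.2.2 * ‖v‖ ^ 2 / 2| ≤ C * ‖v‖ ^ 2 / 2 := by
          rw [abs_div, abs_mul, abs_of_nonneg (by positivity : (0 : ℝ) ≤ ‖v‖ ^ 2), abs_two]
          gcongr
        have hk : |lamInv * κv| ≤ |lamInv| * (C * (1 + ‖v‖ ^ 2)) := by
          rw [abs_mul]
          gcongr
        linarith
    _ ≤ (3 * C + |lamInv| * C) * (1 + ‖v‖ ^ 2) := by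
        nlinarith [mul_nonneg hC0 hv0, mul_nonneg hC0 (sq_nonneg ‖v‖), abs_nonneg lamInv,
          mul_nonneg (abs_nonneg lamInv) hC0]

/-- **The collision increment.** If `|φ(x, v)| ≤ C_φ (1+|v|²)` for all `x, v`, then for a unit
vector `ω` and the elastic pair `v' = v − ⟪v−w,ω⟫ω`, `w' = w + ⟪v−w,ω⟫ω`,
`|φ(x, v') + φ(y, w') − φ(x, v) − φ(y, w)| ≤ 18 C_φ (1+|v|²)(1+|w|²)`. [folklore] -/
theorem abs_increment_le {φ : T3 → V3 → ℝ} {Cφ : ℝ} (hφ : ∀ x v, |φ x v| ≤ Cφ * (1 + ‖v‖ ^ 2))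
    (x y : T3) (v w : V3) (ω : Metric.sphere (0 : V3) 1) :
    |φ x (v - ⟪v - w, (ω : V3)⟫_ℝ • (ω : V3)) + φ y (w + ⟪v - w, (ω : V3)⟫_ℝ • (ω : V3)) -
        φ x v - φ y w| ≤ 18 * Cφ * ((1 + ‖v‖ ^ 2) * (1 + ‖w‖ ^ 2)) := by
  have hC0 : 0 ≤ Cφ := by
    have := hφ x 0
    simp only [norm_zero, ne_eq, OfNat.ofNat_ne_zero, not_false_eq_true, zero_pow, add_zero,
      mul_one] at this
    exact (abs_nonneg _).trans this
  have hω : ‖(ω : V3)‖ = 1 := norm_eq_of_mem_sphere ω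
  have hinner : |⟪v - w, (ω : V3)⟫_ℝ| ≤ ‖v - w‖ := by
    simpa [hω] using abs_real_inner_le_norm (v - w) (ω : V3)
  have hv' : 1 + ‖v - ⟪v - w, (ω : V3)⟫_ℝ • (ω : V3)‖ ^ 2 ≤ 8 * ((1 + ‖v‖ ^ 2) * (1 + ‖w‖ ^ 2)) := by
    have := one_add_norm_sq_out_le v w ω (-⟪v - w, (ω : V3)⟫_ℝ) (by rw [abs_neg]; exact hinner)
    simpa [sub_eq_add_neg, neg_smul] using this
  have hw' : 1 + ‖w + ⟪v - w, (ω : V3)⟫_ℝ • (ω : V3)‖ ^ 2 ≤ 8 * ((1 + ‖v‖ ^ 2) * (1 + ‖w‖ ^ 2)) := by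
    have := one_add_norm_sq_out_le w v ω (⟪v - w, (ω : V3)⟫_ℝ) (by rw [norm_sub_rev]; exact hinner)
    linarith [mul_comm (1 + ‖v‖ ^ 2) (1 + ‖w‖ ^ 2)]
  have hvv : 1 + ‖v‖ ^ 2 ≤ (1 + ‖v‖ ^ 2) * (1 + ‖w‖ ^ 2) :=
    le_mul_of_one_le_right (by positivity) (by nlinarith [sq_nonneg ‖w‖])
  have hww : 1 + ‖w‖ ^ 2 ≤ (1 + ‖v‖ ^ 2) * (1 + ‖w‖ ^ 2) :=
    le_mul_of_one_le_left (by positivity) (by nlinarith [sq_nonneg ‖v‖])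
  calc |φ x (v - ⟪v - w, (ω : V3)⟫_ℝ • (ω : V3)) + φ y (w + ⟪v - w, (ω : V3)⟫_ℝ • (ω : V3)) -
        φ x v - φ y w|
      ≤ |φ x (v - ⟪v - w, (ω : V3)⟫_ℝ • (ω : V3))| + |φ y (w + ⟪v - w, (ω : V3)⟫_ℝ • (ω : V3))| +
        |φ x v| + |φ y w| := by
        refine (abs_sub _ _).trans (add_le_add ((abs_sub _ _).trans
          (add_le_add (abs_add_le _ _) le_rfl)) le_rfl)
    _ ≤ Cφ * (8 * ((1 + ‖v‖ ^ 2) * (1 + ‖w‖ ^ 2))) + Cφ * (8 * ((1 + ‖v‖ ^ 2) * (1 + ‖w‖ ^ 2))) +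
        Cφ * ((1 + ‖v‖ ^ 2) * (1 + ‖w‖ ^ 2)) + Cφ * ((1 + ‖v‖ ^ 2) * (1 + ‖w‖ ^ 2)) := by
        gcongr
        · exact (hφ _ _).trans (mul_le_mul_of_nonneg_left hv' hC0)
        · exact (hφ _ _).trans (mul_le_mul_of_nonneg_left hw' hC0)
        · exact (hφ _ _).trans (mul_le_mul_of_nonneg_left hvv hC0)
        · exact (hφ _ _).trans (mul_le_mul_of_nonneg_left hww hC0)
    _ = 18 * Cφ * ((1 + ‖v‖ ^ 2) * (1 + ‖w‖ ^ 2)) := by ring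

/-! ## The growth bound -/

/-- **Growth bound for the test-side Enskog operator on the window `[0, t]`.** Let
`L(s, x, v) = λ ∫_{S²} ∫ ((v−w)·ω)₊ Yf(s, x_ω) g(s, y_ω, w) M_{1, θ(s,y_ω), u(s,y_ω)}(w) Δφ dw dσ(ω)`
where on `[0, t] × 𝕋³`: `|Yf| ≤ Ȳ` (contact value on the packing window), `0 ≤ g ≤ R` (density),
`‖u‖ ≤ U`, `0 < θ ≤ Θ`, and `|φ(s, x, v)| ≤ C_φ(1+|v|²)`. Then
`|L(s, x, v)| ≤ K (1+|v|²)²` for `s ∈ [0, t]`, with `K` independent of `(s, x, v)`.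
[cite: PulvirentiSimonella2016, §2] -/
theorem abs_enskogL_le {t : ℝ} {Yf g θf : ℝ → T3 → ℝ} {uf : ℝ → T3 → V3}
    {φ : ℝ → T3 → V3 → ℝ} {xs ys : T3 → Metric.sphere (0 : V3) 1 → T3}
    {Ybar R U Θ Cφ lam : ℝ}
    (hY : ∀ s ∈ Icc 0 t, ∀ x, |Yf s x| ≤ Ybar) (hg : ∀ s ∈ Icc 0 t, ∀ x, 0 ≤ g s x ∧ g s x ≤ R)
    (hu : ∀ s ∈ Icc 0 t, ∀ x, ‖uf s x‖ ≤ U) (hθ : ∀ s ∈ Icc 0 t, ∀ x, 0 < θf s x ∧ θf s x ≤ Θ)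
    (hφ : ∀ s ∈ Icc 0 t, ∀ x v, |φ s x v| ≤ Cφ * (1 + ‖v‖ ^ 2))
    (L : ℝ → T3 → V3 → ℝ)
    (hL : ∀ s x v, L s x v = lam * ∫ ω : Metric.sphere (0 : V3) 1, (∫ w : V3,
      max ⟪v - w, (ω : V3)⟫_ℝ 0 * Yf s (xs x ω) *
        (g s (ys x ω) * localMaxwellian 1 (θf s (ys x ω)) (uf s (ys x ω)) w) *
        (φ s x (v - ⟪v - w, (ω : V3)⟫_ℝ • (ω : V3)) + φ s (ys x ω) (w + ⟪v - w, (ω : V3)⟫_ℝ • (ω : V3)) -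
          φ s x v - φ s (ys x ω) w)) ∂sphereMeasure) :
    ∃ K : ℝ, 0 ≤ K ∧ ∀ s ∈ Icc 0 t, ∀ x v, |L s x v| ≤ K * (1 + ‖v‖ ^ 2) ^ 2 := by
  obtain ⟨CG, hCG0, hCG⟩ := exists_integral_one_add_norm_sq_sq_gaussMeasure_le U Θ
  haveI : IsFiniteMeasure (sphereMeasure : Measure (Metric.sphere (0 : V3) 1)) := by
    unfold sphereMeasure; infer_instance
  set S : ℝ := (sphereMeasure : Measure (Metric.sphere (0 : V3) 1)).real Set.univ with hS
  have hS0 : 0 ≤ S := measureReal_nonneg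
  refine ⟨|lam| * (S * (|Ybar| * |R| * (18 * |Cφ|) * CG)), by positivity, fun s hs x v => ?_⟩
  rw [hL s x v, abs_mul]
  -- the bound on the inner `w`-integral, uniformly in `ω`
  have hinner : ∀ ω : Metric.sphere (0 : V3) 1,
      ‖∫ w : V3, max ⟪v - w, (ω : V3)⟫_ℝ 0 * Yf s (xs x ω) *
        (g s (ys x ω) * localMaxwellian 1 (θf s (ys x ω)) (uf s (ys x ω)) w) *
        (φ s x (v - ⟪v - w, (ω : V3)⟫_ℝ • (ω : V3)) + φ s (ys x ω) (w + ⟪v - w, (ω : V3)⟫_ℝ • (ω : V3)) -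
          φ s x v - φ s (ys x ω) w)‖ ≤
        |Ybar| * |R| * (18 * |Cφ|) * CG * (1 + ‖v‖ ^ 2) ^ 2 := by
    intro ω
    set y := ys x ω with hy
    have hθy := hθ s hs y
    have hgy := hg s hs y
    have hω : ‖(ω : V3)‖ = 1 := norm_eq_of_mem_sphere ω
    -- pointwise domination by a Gaussian moment
    have hφ' : ∀ x' v', |φ s x' v'| ≤ |Cφ| * (1 + ‖v'‖ ^ 2) := fun x' v' =>
      (hφ s hs x' v').trans (mul_le_mul_of_nonneg_right (le_abs_self _) (by positivity))
    have hdom : ∀ w : V3,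
        ‖max ⟪v - w, (ω : V3)⟫_ℝ 0 * Yf s (xs x ω) *
          (g s y * localMaxwellian 1 (θf s y) (uf s y) w) *
          (φ s x (v - ⟪v - w, (ω : V3)⟫_ℝ • (ω : V3)) + φ s y (w + ⟪v - w, (ω : V3)⟫_ℝ • (ω : V3)) -
            φ s x v - φ s y w)‖ ≤
          localMaxwellian 1 (θf s y) (uf s y) w *
            (|Ybar| * |R| * (18 * |Cφ|) * (1 + ‖v‖ ^ 2) ^ 2 * (1 + ‖w‖ ^ 2) ^ 2) := by
      intro w
      have hM0 : 0 ≤ localMaxwellian 1 (θf s y) (uf s y) w :=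
        localMaxwellian_nonneg zero_le_one hθy.1.le _ _
      have hmax : |max ⟪v - w, (ω : V3)⟫_ℝ 0| ≤ (1 + ‖v‖ ^ 2) * (1 + ‖w‖ ^ 2) := by
        have h1 : |max ⟪v - w, (ω : V3)⟫_ℝ 0| ≤ ‖v - w‖ := by
          rw [abs_of_nonneg (le_max_right _ _)]
          refine max_le ?_ (norm_nonneg _)
          have := abs_real_inner_le_norm (v - w) (ω : V3)
          rw [hω, mul_one] at this
          exact (le_abs_self _).trans this
        have h2 : ‖v - w‖ ≤ ‖v‖ + ‖w‖ := norm_sub_le v w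
        have hv1 : ‖v‖ ≤ (1 + ‖v‖ ^ 2) / 2 := by nlinarith [sq_nonneg (‖v‖ - 1)]
        have hw1 : ‖w‖ ≤ (1 + ‖w‖ ^ 2) / 2 := by nlinarith [sq_nonneg (‖w‖ - 1)]
        have hprod : (1 + ‖v‖ ^ 2) / 2 + (1 + ‖w‖ ^ 2) / 2 ≤ (1 + ‖v‖ ^ 2) * (1 + ‖w‖ ^ 2) := by
          nlinarith [sq_nonneg ‖v‖, sq_nonneg ‖w‖, mul_nonneg (sq_nonneg ‖v‖) (sq_nonneg ‖w‖)]
        linarith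
      have hinc := abs_increment_le (φ := φ s) hφ' x y v w ω
      have hYb : |Yf s (xs x ω)| ≤ |Ybar| := (hY s hs _).trans (le_abs_self _)
      have hgb : |g s y| ≤ |R| := by rw [abs_of_nonneg hgy.1]; exact hgy.2.trans (le_abs_self _)
      rw [Real.norm_eq_abs, abs_mul, abs_mul, abs_mul, abs_mul, abs_of_nonneg hM0]
      calc |max ⟪v - w, (ω : V3)⟫_ℝ 0| * |Yf s (xs x ω)| * (|g s y| * localMaxwellian 1 (θf s y) (uf s y) w) *
            |φ s x (v - ⟪v - w, (ω : V3)⟫_ℝ • (ω : V3)) + φ s y (w + ⟪v - w, (ω : V3)⟫_ℝ • (ω : V3)) -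
              φ s x v - φ s y w|
          ≤ ((1 + ‖v‖ ^ 2) * (1 + ‖w‖ ^ 2)) * |Ybar| * (|R| * localMaxwellian 1 (θf s y) (uf s y) w) *
            (18 * |Cφ| * ((1 + ‖v‖ ^ 2) * (1 + ‖w‖ ^ 2))) := by
            gcongr
        _ = _ := by ring
    have hint : Integrable (fun w : V3 => localMaxwellian 1 (θf s y) (uf s y) w *
        (|Ybar| * |R| * (18 * |Cφ|) * (1 + ‖v‖ ^ 2) ^ 2 * (1 + ‖w‖ ^ 2) ^ 2)) := by
      rw [integrable_localMaxwellian_mul_iff hθy.1]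
      exact (integrable_one_add_norm_sq_pow_gaussMeasure _ _ 2).const_mul _
    refine (norm_integral_le_of_norm_le hint (Eventually.of_forall hdom)).trans ?_
    rw [integral_localMaxwellian_mul_eq_integral_gaussMeasure hθy.1, integral_const_mul]
    have hCGy := hCG (uf s y) (θf s y) (hu s hs y) hθy.1 hθy.2
    have : 0 ≤ |Ybar| * |R| * (18 * |Cφ|) * (1 + ‖v‖ ^ 2) ^ 2 := by positivity
    nlinarith
  -- the `ω`-integral over the finite sphere measure
  have hconst : Integrable (fun _ : Metric.sphere (0 : V3) 1 =>
      |Ybar| * |R| * (18 * |Cφ|) * CG * (1 + ‖v‖ ^ 2) ^ 2) sphereMeasure := integrable_const _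
  have hJ := norm_integral_le_of_norm_le hconst (Eventually.of_forall hinner)
  rw [Real.norm_eq_abs, integral_const, smul_eq_mul] at hJ
  calc _ ≤ |lam| * (S * (|Ybar| * |R| * (18 * |Cφ|) * CG * (1 + ‖v‖ ^ 2) ^ 2)) :=
        mul_le_mul_of_nonneg_left hJ (abs_nonneg _)
    _ = _ := by ring

end Summit.AtomisticToContinuum.HydrodynamicLimit.Theorems

end
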